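import Summits.FinalStateConjecture.FinalStateConjecture.Theorems.EIHFluxBalanceInertialRecessionStubRechart12Assembly
import Summits.FinalStateConjecture.FinalStateConjecture.Theorems.EIHFluxBalanceInertialRecessionStubRechart12Holes
import Summits.FinalStateConjecture.FinalStateConjecture.Theorems.EIHFluxBalanceInertialRecessionStubRechart3G1
import Summits.FinalStateConjecture.FinalStateConjecture.Theorems.EIHFluxBalanceInertialRecessionRechartSpinZero3
import Summits.FinalStateConjecture.FinalStateConjecture.Statement

/-!
# Route EIHFluxBalance — `InertialRecession` (E′): P2′, RE-CHARTING ON THE GIVEN REGION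
# (stub `stub_rechartOnRegion` of line `SketchCleanExcision`, all spins)

Closing file for the stub `stub_rechartOnRegion` of the crux `stmt-FinalStateConjecture-17403`
(`Summit.FinalStateConjecture.FinalStateConjecture.Theses.EIHFluxBalance.InertialRecession`, E′),
line `SketchCleanExcision` (skeleton r12).

`stub_rechartOnRegion`: under the twelve-clause antecedent of the lab chart `Φ : U → 𝒟`, `0 < N`,
third-order slaving, convergence of the painted velocities, (T) eventual lab-time causality on the
guaranteed region and (O) orthochronous painted frames, there is a `C²` final-state decomposition
`d` OF THE LAB CHART'S OWN REGION `O` with sub-extremal holes, `O = exteriorOf 𝒟 d.charted`,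
honest-radii exhaustion and future orientation — for ALL spins. Route: velocities `ξ̇ᵢ → Vᵢ`
(slaving + painted velocities), Cesàro `‖Vᵢ‖ ≤ κ² < 1` (`norm_cesaro_le`); normalised frames
(`exists_normalisedFrame'`); (Ofut) from (T) (`isFutureDirected_mfderiv_of_labTimeCausality`); the
clock-chart packages of all holes with their dictionaries and reach (`clockCharts_packages_r12`,
…StubRechart12Holes/Clock, over `clockChart_package`); the radiation-zone package for every flat
profile (`flat_radiationZone_package_general`); and the assembly ON `O`
(`exists_finalStateDecomposition_onRegion_of_clockCharts`, …StubRechart12Assembly: profiles,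
transfer …StubRechart12Transfer over …RechartTransfer3, lagged boosted charts …RechartLagBackground,
orientation …StubRechart12Orient/…StubRechart11Orient, assembler
`exists_finalStateDecomposition_onRegion_of_rechart'` of …StubRechart11Region).
[O'Neill 1983, Ch. 14; Dafermos–Rodnianski arXiv:0811.0354, §5.1; folklore]
-/

set_option linter.dupNamespace false

noncomputable section

namespace Summit.FinalStateConjecture.FinalStateConjecture.Theorems

open scoped BigOperators Topology Manifold Classical MeasureTheory Matrix InnerProductSpace ContDiff ENNReal
open Filter Set Function TopologicalSpace MeasureTheory Literature.Geometry.Lorentzian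

/-! ### Painted radius versus lab distance -/

/-- **The painted radius is at most a frame constant times the lab distance to the centre**
(registered carrier `paintedRadius_le_mul_dist_rechart12` of the crux item):
`r_a(Λ⁻¹(x − (x⁰, ζ))) ≤ ‖Λ⁻¹‖‖x̃ − ζ‖ ≤ (1 + 3|(Λe₀)⁰|)‖x̃ − ζ‖`. [folklore] -/
theorem paintedRadius_le_mul_dist_rechart12 : open Literature.Geometry.Lorentzian in ∀ (Λ : lorentzGroup) (a : ℝ) (x : E4) (ζ : E3), Kerr.radius a (poincareInv Λ (E4.ofTimeSpace (x 0) ζ) x) ≤ (1 + 3 * |((Λ : E4 ≃L[ℝ] E4) (E4.basisVector 0)) 0|) * ‖E4.spatial x - ζ‖ := by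
  intro Λ a x ζ
  set w : E4 := x - E4.ofTimeSpace (x 0) ζ with hw
  have hw0 : w 0 = 0 := by
    rw [hw, PiLp.sub_apply, E4.ofTimeSpace_apply_zero, sub_self]
  have hws : E4.spatial w = E4.spatial x - ζ := by
    rw [hw, map_sub, E4.spatial_ofTimeSpace]
  have hwn : ‖w‖ = ‖E4.spatial x - ζ‖ := by
    rw [norm_eq_spatialNorm_of_apply_zero_eq_zero hw0, ← hws]; rfl
  have h1 : Kerr.radius a (poincareInv Λ (E4.ofTimeSpace (x 0) ζ) x) ≤ ‖poincareInv Λ (E4.ofTimeSpace (x 0) ζ) x‖ := by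
    refine (Kerr.radius_le_spatialNorm a _).trans ?_
    have h := norm_sq_eq_sq_add_spatialNorm_sq (poincareInv Λ (E4.ofTimeSpace (x 0) ζ) x)
    nlinarith [norm_nonneg (poincareInv Λ (E4.ofTimeSpace (x 0) ζ) x),
      E4.spatialNorm_nonneg (poincareInv Λ (E4.ofTimeSpace (x 0) ζ) x),
      sq_nonneg ((poincareInv Λ (E4.ofTimeSpace (x 0) ζ) x) 0)]
  have h2 : ‖poincareInv Λ (E4.ofTimeSpace (x 0) ζ) x‖ ≤ ‖((Λ : E4 ≃L[ℝ] E4).symm : E4 →L[ℝ] E4)‖ * ‖w‖ := by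
    rw [poincareInv, ← hw]
    exact ((Λ : E4 ≃L[ℝ] E4).symm : E4 →L[ℝ] E4).le_opNorm w
  have h3 := norm_lorentz_symm_le Λ
  rw [hwn] at h2
  exact h1.trans (h2.trans (mul_le_mul_of_nonneg_right h3 (norm_nonneg _)))

/-! ### The stub -/

-- long statement and long bookkeeping proof
set_option maxHeartbeats 1600000 in
/-- **P2′ · RE-CHARTING ON THE GIVEN REGION** (stub `stub_rechartOnRegion` of line
`SketchCleanExcision`, all spins). See the module docstring. [folklore] -/
theorem stub_rechartOnRegion : ∀ (X : Type) [TopologicalSpace X] [ChartedSpace E3 X] [IsManifold (𝓡 3) ((⊤ : ℕ∞) : WithTop ℕ∞) X] [T2Space X] [SecondCountableTopology X] [ConnectedSpace X], ∀ D ∈ admissibleVacuumData X, ∀ 𝒟 : VacuumCauchyDevelopment D, 𝒟.IsMaximal → ∀ (N : ℕ) (M a rin : Fin N → ℝ) (Λ : Fin N → ℝ → lorentzGroup) (ξ : Fin N → ℝ → E3) (γ κ τ₀ : ℝ) (U : Opens E4) (Φ : U → 𝒟.carrier) (O : Set 𝒟.carrier), ((∀ i, Kerr.IsSubextremal (M i)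 (a i) ∧ Kerr.rMinus (M i) (a i) < rin i ∧ rin i < Kerr.rPlus (M i) (a i)) ∧ (∀ i t, |((Λ i t : E4 ≃L[ℝ] E4) (E4.basisVector 0)) 0| ≤ γ) ∧ (∀ i, ContDiff ℝ ((⊤ : ℕ∞) : WithTop ℕ∞) (ξ i) ∧ ContDiff ℝ ((⊤ : ℕ∞) : WithTop ℕ∞) (fun t ↦ ((Λ i t : E4 ≃L[ℝ] E4) : E4 →L[ℝ] E4))) ∧ (∀ i j, i ≠ j → Tendsto (fun t ↦ ‖ξ i t - ξ j t‖) atTop atTop) ∧ (0 < κ ∧ κ < 1 ∧ ∀ i, ∀ᶠ t in atTop, ‖ξ i t‖ ≤ κ ^ 2 * t) ∧ ({x : E4 | τ₀ < x 0 ∧ ∀ i, rin i < Kerr.radius (a i) (poincareInv (Λ i (x 0)) (E4.ofTimeSpace (x 0) (ξ i (x 0))) x)} ⊆ (U : Set E4)) ∧ let B : ModelBackground := ⟨U, fun x ↦ Minkowski.bilin + ∑ i, (boostedKerrBilin (Λ i (x 0)) (E4.ofTimeSpace (x 0) (ξ i (x 0))) (M i) (a i) x - Minkowski.bilin), fun x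 ↦ x 0, E4.spatialNorm⟩; ContMDiff 𝓘(ℝ, E4) (𝓡 4) ((⊤ : ℕ∞) : WithTop ℕ∞) Φ ∧ Topology.IsOpenEmbedding ((B.lateRegion τ₀).restrict Φ) ∧ Φ '' {x : U | τ₀ < x.1 0 ∧ ∀ i, Kerr.rPlus (M i) (a i) < Kerr.radius (a i) (poincareInv (Λ i (x.1 0)) (E4.ofTimeSpace (x.1 0) (ξ i (x.1 0))) x.1)} ⊆ O ∧ Tendsto (fun t ↦ 𝒟.toSpacetime.deviationCk B Φ 3 t) atTop (𝓝 0) ∧ Tendsto (fun t : ℝ ↦ ⨆ x ∈ {x : U | x.1 0 = t ∧ E4.spatialNorm x.1 ≤ κ * t}, ⨆ (m : ℕ) (_ : m ≤ 3), ENNReal.ofReal (1 + √(√((⨅ i, ‖E4.spatial x.1 - ξ i t‖) ^ 7))) * ‖iteratedFDeriv ℝ m (𝒟.toSpacetime.deviationExtend B Φ) x.1‖ₑ) atTop (𝓝 0) ∧ O = Summit.FinalStateConjecture.exteriorOf 𝒟.toCauchyDevelopment (Φ '' {x : U | τ₀ < x.1 0 ∧ ∀ i, Kerr.rPlus (M i)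 (a i) < Kerr.radius (a i) (poincareInv (Λ i (x.1 0)) (E4.ofTimeSpace (x.1 0) (ξ i (x.1 0))) x.1)}) ∧ ∀ t₁ : ℝ, τ₀ < t₁ → O \ Φ '' {x : U | t₁ < x.1 0 ∧ ∀ i, Kerr.rPlus (M i) (a i) < Kerr.radius (a i) (poincareInv (Λ i (x.1 0)) (E4.ofTimeSpace (x.1 0) (ξ i (x.1 0))) x.1)} ⊆ 𝒟.metric.causalPast 𝒟.timeOrientation (Φ '' {x : U | x.1 0 = t₁ ∧ ∀ i, Kerr.rPlus (M i) (a i) < Kerr.radius (a i) (poincareInv (Λ i (x.1 0)) (E4.ofTimeSpace (x.1 0) (ξ i (x.1 0))) x.1)})) → 0 < N →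
    (∀ i : Fin N, (∀ m : ℕ, 1 ≤ m → m ≤ 3 → Tendsto (fun t ↦ iteratedDeriv m (fun s ↦ (((Λ i s : lorentzGroup) : E4 ≃L[ℝ] E4) (E4.basisVector 0))) t) atTop (𝓝 0)) ∧ (∀ m : ℕ, m ≤ 2 → Tendsto (fun t ↦ iteratedDeriv m (fun s ↦ deriv (ξ i) s - (((((Λ i s : lorentzGroup) : E4 ≃L[ℝ] E4) (E4.basisVector 0)) 0)⁻¹ • E4.spatial (((Λ i s : lorentzGroup) : E4 ≃L[ℝ] E4) (E4.basisVector 0)))) t) atTop (𝓝 0)) ∧ (a i ≠ 0 → ∀ m : ℕ, 1 ≤ m → m ≤ 3 → Tendsto (fun t ↦ iteratedDeriv m (fun s ↦ (((Λ i s : lorentzGroup) : E4 ≃L[ℝ] E4) (E4.basisVector 3))) t) atTop (𝓝 0))) →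
    (∀ i : Fin N, ∃ V : E3, Tendsto (fun t ↦ ((((Λ i t : lorentzGroup) : E4 ≃L[ℝ] E4) (E4.basisVector 0)) 0)⁻¹ • E4.spatial (((Λ i t : lorentzGroup) : E4 ≃L[ℝ] E4) (E4.basisVector 0))) atTop (𝓝 V)) →
    (∃ τ₁ : ℝ, ∀ x y : U, (τ₁ < x.1 0 ∧ ∀ i, rin i < Kerr.radius (a i) (poincareInv (Λ i (x.1 0)) (E4.ofTimeSpace (x.1 0) (ξ i (x.1 0))) x.1)) → (τ₁ < y.1 0 ∧ ∀ i, rin i < Kerr.radius (a i) (poincareInv (Λ i (y.1 0)) (E4.ofTimeSpace (y.1 0) (ξ i (y.1 0))) y.1)) → Φ y ∈ 𝒟.metric.causalFuture 𝒟.timeOrientation {Φ x} → x.1 0 ≤ y.1 0) →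
    (∀ (i : Fin N) (t : ℝ), 0 < (((Λ i t : lorentzGroup) : E4 ≃L[ℝ] E4) (E4.basisVector 0)) 0) →
    ∃ d : FinalStateDecomposition 𝒟.toSpacetime O 2, (∀ i, Kerr.IsSubextremal (d.mass i) (d.spin i)) ∧ O = Summit.FinalStateConjecture.exteriorOf 𝒟.toCauchyDevelopment d.charted ∧ Summit.FinalStateConjecture.HasExhaustiveCharts d ∧ Summit.FinalStateConjecture.IsFutureOriented d := by
  intro X _ _ _ _ _ _ D hD 𝒟 h𝒟 N M a rin Λ ξ γ κ τ₀ U Φ O hL _hN hS hv hT hOrth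
  obtain ⟨τ₁T, hT₁⟩ := hT
  obtain ⟨hsub, hγb, hsm, hsep, hκ, hU, hB⟩ := hL
  obtain ⟨hΦ, hemb, himO, hdev, -, hO, hexh⟩ := hB
  beta_reduce at hemb hdev
  -- ### notation
  set rpE : Fin N → E4 → ℝ := fun j x ↦ Kerr.radius (a j)
    (poincareInv (Λ j (x 0)) (E4.ofTimeSpace (x 0) (ξ j (x 0))) x) with hrpE
  have hrpc : ∀ j, Continuous (rpE j) := fun j ↦
    continuous_paintedRadius (a j) (Λ j) (ξ j) (hsm j).2.continuous (hsm j).1.continuous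
  have hrin : ∀ j, rin j < Kerr.rPlus (M j) (a j) := fun j ↦ (hsub j).2.2
  have hsub' : ∀ i, Kerr.IsSubextremal (M i) (a i) := fun i ↦ (hsub i).1
  have hrPlus : ∀ i, 0 < Kerr.rPlus (M i) (a i) := fun i ↦ by
    have h1 : 0 < M i := (hsub' i).pos
    unfold Kerr.rPlus; linarith [Real.sqrt_nonneg (M i ^ 2 - a i ^ 2)]
  have hembΦ : Topology.IsOpenEmbedding (({x : U | τ₀ < x.1 0} : Set U).restrict Φ) := hemb
  -- ### (Ofut) from lab-time causality, on `Q = {TO < x⁰, rinⱼ < rpⱼ}`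
  set TO : ℝ := max τ₀ τ₁T with hTO
  set Q : U → Prop := fun x ↦ TO < x.1 0 ∧ ∀ j, rin j < rpE j x.1 with hQ
  have hOfut : ∀ x : U, Q x → ∀ w : E4, 0 < w 0 →
      𝒟.metric.val (Φ x) (mfderiv 𝓘(ℝ, E4) (𝓡 4) Φ x w) (mfderiv 𝓘(ℝ, E4) (𝓡 4) Φ x w) < 0 →
        𝒟.timeOrientation.IsFutureDirected (mfderiv 𝓘(ℝ, E4) (𝓡 4) Φ x w) := by
    intro x hx w hw htl
    have hopen := isOpen_setOf_lt_radius_poincareInv a rin Λ ξ TO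
      (fun i ↦ (hsm i).2.continuous) (fun i ↦ (hsm i).1.continuous)
    exact isFutureDirected_mfderiv_of_labTimeCausality hΦ hopen
      (fun z hz ↦ hU ⟨(le_max_left _ _).trans_lt hz.1, hz.2⟩)
      (fun x' y' hx' hy' hJ ↦ hT₁ x' y' ⟨(le_max_right _ _).trans_lt hx'.1, hx'.2⟩
        ⟨(le_max_right _ _).trans_lt hy'.1, hy'.2⟩ hJ) x hx hw htl
  have hQof : ∀ x : U, TO < x.1 0 → (∀ j, Kerr.rPlus (M j) (a j) < rpE j x.1) → Q x :=
    fun x hx hP ↦ ⟨hx, fun j ↦ (hrin j).trans (hP j)⟩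
  have hT' : ∀ x x' : U, τ₁T < x.1 0 → (∀ j, Kerr.rPlus (M j) (a j) < rpE j x.1) → τ₁T < x'.1 0 →
      (∀ j, Kerr.rPlus (M j) (a j) < rpE j x'.1) →
      Φ x' ∈ 𝒟.metric.causalFuture 𝒟.timeOrientation {Φ x} → x.1 0 ≤ x'.1 0 :=
    fun x x' hx hxP hx' hx'P hJ ↦ hT₁ x x' ⟨hx, fun j ↦ (hrin j).trans (hxP j)⟩
      ⟨hx', fun j ↦ (hrin j).trans (hx'P j)⟩ hJ
  -- ### final velocities
  have hVel : ∀ i : Fin N, ∃ V : E3, Tendsto (deriv (ξ i)) atTop (𝓝 V) := by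
    intro i
    obtain ⟨V, hV⟩ := hv i
    refine ⟨V, ?_⟩
    have hmis : Tendsto (fun t ↦ deriv (ξ i) t - ((((Λ i t : lorentzGroup) : E4 ≃L[ℝ] E4)
        (E4.basisVector 0)) 0)⁻¹ • E4.spatial (((Λ i t : lorentzGroup) : E4 ≃L[ℝ] E4)
          (E4.basisVector 0))) atTop (𝓝 0) := by
      simpa using (hS i).2.1 0 (Nat.zero_le 2)
    have h := hmis.add hV
    rw [zero_add] at h
    exact h.congr fun t ↦ by simp
  have hCes : ∀ i : Fin N, ∃ V : E3, Tendsto (fun t : ℝ ↦ t⁻¹ • ξ i t) atTop (𝓝 V) := fun i ↦ by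
    obtain ⟨V, hV⟩ := hVel i
    exact ⟨V, cesaro_of_tendsto_deriv_rechart ((hsm i).1.differentiable (by simp)) hV⟩
  choose V hVc using hCes
  have hκ2 : κ ^ 2 < 1 := by nlinarith [hκ.1, hκ.2.1]
  have hV1 : ∀ i, ‖V i‖ < 1 := fun i ↦ (SublinearIsFree.Rechart.norm_cesaro_le (hVc i) (hκ.2.2 i)).trans_lt hκ2
  -- ### normalised frames
  set γ' : ℝ := max γ 1 with hγ'
  have hγ1 : 1 ≤ γ' := le_max_right _ _
  have hγ'b : ∀ i t, |((Λ i t : E4 ≃L[ℝ] E4) (E4.basisVector 0)) 0| ≤ γ' :=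
    fun i t ↦ (hγb i t).trans (le_max_left _ _)
  have hnorm : ∀ i, ∃ Λ' : ℝ → lorentzGroup, ContDiff ℝ ∞ (fun t ↦ ((Λ' t : E4 ≃L[ℝ] E4) : E4 →L[ℝ] E4)) ∧
      (∀ t, (Λ' t : E4 ≃L[ℝ] E4) (E4.basisVector 0) = (Λ i t : E4 ≃L[ℝ] E4) (E4.basisVector 0)) ∧
      (∀ m, 1 ≤ m → m ≤ 3 → Tendsto (fun t ↦ iteratedDeriv m
        (fun s ↦ ((Λ' s : E4 ≃L[ℝ] E4) : E4 →L[ℝ] E4)) t) atTop (𝓝 0)) ∧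
      (∀ t c x, boostedKerrBilin (Λ i t) c (M i) (a i) x = boostedKerrBilin (Λ' t) c (M i) (a i) x) ∧
      (∀ t c x, Kerr.radius (a i) (poincareInv (Λ i t) c x) = Kerr.radius (a i) (poincareInv (Λ' t) c x)) :=
    fun i ↦ SublinearIsFree.Rechart.exists_normalisedFrame' (Λ i) γ' (M i) (a i) (hsm i).2 (hγ'b i) (hOrth i) (hS i).1 (hS i).2.2
  choose Λt hΛt he₀ hdec hbil' hrad' using hnorm
  have hbil : ∀ j t x, boostedKerrBilin (Λt j t) (E4.ofTimeSpace t (ξ j t)) (M j) (a j) x =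
      boostedKerrBilin (Λ j t) (E4.ofTimeSpace t (ξ j t)) (M j) (a j) x := fun j t x ↦ (hbil' j t _ x).symm
  have hrad : ∀ j t x, Kerr.radius (a j) (poincareInv (Λt j t) (E4.ofTimeSpace t (ξ j t)) x) =
      Kerr.radius (a j) (poincareInv (Λ j t) (E4.ofTimeSpace t (ξ j t)) x) := fun j t x ↦ (hrad' j t _ x).symm
  have huγ : ∀ j t, |((Λt j t : E4 ≃L[ℝ] E4) (E4.basisVector 0)) 0| ≤ γ' := fun j t ↦ by
    rw [he₀]; exact hγ'b j t
  have hpos' : ∀ j t, 0 < ((Λt j t : E4 ≃L[ℝ] E4) (E4.basisVector 0)) 0 := fun j t ↦ by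
    rw [he₀]; exact hOrth j t
  have hmis : ∀ j, ∀ m : ℕ, m ≤ 2 → Tendsto (fun t ↦ iteratedDeriv m (fun s ↦ deriv (ξ j) s -
      ((((Λt j s : E4 ≃L[ℝ] E4) (E4.basisVector 0)) 0)⁻¹ •
        E4.spatial ((Λt j s : E4 ≃L[ℝ] E4) (E4.basisVector 0)))) t) atTop (𝓝 0) := by
    intro j m hm
    have h := (hS j).2.1 m hm
    simp only [he₀]
    exact h
  have hξ : ∀ j, ContDiff ℝ ∞ (ξ j) := fun j ↦ (hsm j).1
  have hΛ : ∀ j, ContDiff ℝ ∞ (fun t ↦ ((Λ j t : E4 ≃L[ℝ] E4) : E4 →L[ℝ] E4)) := fun j ↦ (hsm j).2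
  -- ### the clock-chart packages
  obtain ⟨A, hAU, T₀, θ, β, Rr, S, Tlab, tcov, hAc, hAlate, hradii, hQA, hψemb, hconvR, hdisjB, hT₀s,
      hclock, htop, hhon, hθtop, hθbd, hβ0, hβB, hslack, hRrm, hRrt, hRrc, hreach, hcov, hlab⟩ :=
    clockCharts_packages_r12 𝒟.toSpacetime M a rin Λ Λt ξ hsub' hrin hbil hrad hΛ hξ hΛt hdec hγ1 huγ hpos'
      hmis hsep U Φ hΦ hdev (le_max_left τ₀ τ₁T) hU hembΦ Q hQof hOfut V hV1
  have hAlate' : ∀ i (y : E4), τ₀ < A i y 0 := fun i y ↦ (le_max_left _ _).trans_lt (hAlate i y)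
  have hposF : ∀ i t, 0 < SublinearIsFree.Rechart.frameVel (Λt i t) 0 := fun i t ↦ hpos' i t
  have hdecT : ∀ i, Tendsto (fun t ↦ deriv (fun s ↦ SublinearIsFree.Rechart.frameTilt (Λt i s)) t) atTop (𝓝 0) :=
    fun i ↦ by
    have h := SublinearIsFree.Rechart.tendsto_iteratedDeriv_frameTilt (Λt i) (hΛt i) (hdec i) 1 le_rfl (by norm_num)
    simpa only [iteratedDeriv_one] using h
  -- ### the common lag and the tilt bounds
  set sL : ℝ := 1 + ∑ i, |T₀ i 0| with hsL
  have hsLi : ∀ i, 1 + |T₀ i 0| ≤ sL := fun i ↦ by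
    have : |T₀ i 0| ≤ ∑ j, |T₀ j 0| :=
      Finset.single_le_sum (f := fun j ↦ |T₀ j 0|) (fun _ _ ↦ abs_nonneg _) (Finset.mem_univ i)
    rw [hsL]; linarith
  have hsL0 : 0 ≤ sL := by
    rw [hsL]; linarith [Finset.sum_nonneg (fun i _ ↦ abs_nonneg (T₀ i 0)) (s := Finset.univ)]
  have hθle : ∀ i, ∀ᶠ t in atTop, θ i t ≤ t + sL := fun i ↦ by
    filter_upwards [eventually_ge_atTop (T₀ i 0)] with t ht
    have h1 := hθbd i t ht
    have h2 := neg_abs_le (T₀ i 0)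
    linarith [hsLi i]
  have hslack' : ∀ i (n : ℕ), ∀ᶠ t in atTop, β i t * n ≤ (t - θ i t) + sL := fun i n ↦
    (hslack i n).mono fun t ht ↦ ht.trans (by linarith [hsLi i])
  -- ### painted radius versus lab distance; far points are exterior
  set R₀ : ℝ := 1 + ∑ i, |rin i| + ∑ i, |a i| + ∑ i, Kerr.rPlus (M i) (a i) with hR₀
  have hR₀0 : 0 ≤ R₀ := by
    have h1 : 0 ≤ ∑ i, |rin i| := Finset.sum_nonneg fun i _ ↦ abs_nonneg _
    have h2 : 0 ≤ ∑ i, |a i| := Finset.sum_nonneg fun i _ ↦ abs_nonneg _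
    have h3 : 0 ≤ ∑ i, Kerr.rPlus (M i) (a i) := Finset.sum_nonneg fun i _ ↦ (hrPlus i).le
    rw [hR₀]; linarith
  have hrpd : ∀ (i : Fin N) (x : E4), rpE i x ≤ (1 + 3 * γ') * ‖E4.spatial x - ξ i (x 0)‖ := fun i x ↦
    (paintedRadius_le_mul_dist_rechart12 (Λ i (x 0)) (a i) x (ξ i (x 0))).trans
      (mul_le_mul_of_nonneg_right (by linarith [hγ'b i (x 0)]) (norm_nonneg _))
  have hfar : ∀ (x : E4) (i : Fin N), R₀ ≤ ‖E4.spatial x - ξ i (x 0)‖ → Kerr.rPlus (M i) (a i) < rpE i x := by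
    intro x i hx
    have h2 := SublinearIsFree.Rechart.sub_abs_le_radius_poincareInv (Λ i (x 0)) (a i) (x := x) rfl (ξ i (x 0))
    have h3 : |a i| ≤ ∑ j, |a j| := Finset.single_le_sum (f := fun j ↦ |a j|) (fun _ _ ↦ abs_nonneg _) (Finset.mem_univ i)
    have h4 : Kerr.rPlus (M i) (a i) ≤ ∑ j, Kerr.rPlus (M j) (a j) :=
      Finset.single_le_sum (f := fun j ↦ Kerr.rPlus (M j) (a j)) (fun j _ ↦ (hrPlus j).le) (Finset.mem_univ i)
    have h5 : 0 ≤ ∑ j, |rin j| := Finset.sum_nonneg fun j _ ↦ abs_nonneg _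
    show Kerr.rPlus (M i) (a i) < Kerr.radius (a i) (poincareInv (Λ i (x 0)) (E4.ofTimeSpace (x 0) (ξ i (x 0))) x)
    rw [hR₀] at hx
    linarith
  -- ### the flat package for every admissible profile
  have hdev2 : Tendsto (fun t ↦ 𝒟.toSpacetime.deviationCk ⟨U, fun x ↦ Minkowski.bilin +
      ∑ i, (boostedKerrBilin (Λ i (x 0)) (E4.ofTimeSpace (x 0) (ξ i (x 0))) (M i) (a i) x -
        Minkowski.bilin), fun x ↦ x 0, E4.spatialNorm⟩ Φ 2 t) atTop (𝓝 0) :=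
    tendsto_of_tendsto_of_tendsto_of_le_of_le tendsto_const_nhds hdev (fun _ ↦ zero_le)
      fun t ↦ 𝒟.toSpacetime.deviationCk_mono ⟨U, fun x ↦ Minkowski.bilin +
        ∑ i, (boostedKerrBilin (Λ i (x 0)) (E4.ofTimeSpace (x 0) (ξ i (x 0))) (M i) (a i) x -
          Minkowski.bilin), fun x ↦ x 0, E4.spatialNorm⟩ Φ (by norm_num : 2 ≤ 3) t
  have hflat : ∀ R' : ℝ → ℝ, Continuous R' → (∀ t, R₀ ≤ R' t) → Tendsto R' atTop atTop →
      Tendsto (fun t ↦ R' t / t) atTop (𝓝 0) →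
      ∃ (U₀ : Opens E4) (hU₀ : U₀ ≤ U) (ρ : Fin N → ℝ → ℝ),
        (U₀ : Set E4) = {x : E4 | max τ₀ 0 + 1 < x 0 ∧ ∀ i, R' (x 0) < ‖E4.spatial x - ξ i (x 0)‖} ∧
        (∀ i, Tendsto (fun t ↦ ρ i t / t) atTop (𝓝 0)) ∧
        {x : E4 | max τ₀ 0 + 1 < x 0 ∧ ∀ i, ρ i (x 0) <
          Kerr.radius (a i) (poincareInv (Lorentz.boost (V i) (hV1 i)) 0 x)} ⊆ (U₀ : Set E4) ∧
        Tendsto (fun t ↦ 𝒟.toSpacetime.deviationCk (Minkowski.backgroundOn U₀) (Φ ∘ Opens.inclusion hU₀) 2 t)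
          atTop (𝓝 0) ∧
        Topology.IsOpenEmbedding (((Minkowski.backgroundOn U₀).lateRegion (max τ₀ 0 + 1)).restrict
          (Φ ∘ Opens.inclusion hU₀)) := by
    intro R' hR'c hR'0 hR't hR'd
    have hR'R₀' : ∀ t, 1 + ∑ i, |rin i| + ∑ i, |a i| ≤ R' t := fun t ↦ by
      have h3 : 0 ≤ ∑ i, Kerr.rPlus (M i) (a i) := Finset.sum_nonneg fun i _ ↦ (hrPlus i).le
      have := hR'0 t; rw [hR₀] at this; linarith
    exact SublinearIsFree.Rechart.flat_radiationZone_package_general 𝒟.toSpacetime M a rin Λ Λt ξ τ₀ U Φ hΦ hU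
      hemb hdev2 hbil hΛt hdec hγ1 huγ hpos' hξ hmis V hV1 hVc hR'c hR'R₀' hR't hR'd
  -- ### assembly on the given region
  exact exists_finalStateDecomposition_onRegion_of_clockCharts 𝒟 M a hsub' ξ rpE hrpc U Φ hΦ O hO himO hexh
    hembΦ hT' Q hQof hOfut V hV1 A hAc hAU hAlate' hradii hQA hψemb hconvR hdisjB Λt T₀ hΛt hξ hT₀s hclock
    hposF hdecT htop hhon θ β Rr S tcov Tlab (fun i ↦ (1 + |a i| / Kerr.rPlus (M i) (a i)) * γ')
    (fun _ ↦ 16 * γ' ^ 2) (fun i ↦ 16 * γ' ^ 2 * |a i|) sL hsL0 hθtop hθle hβ0 hβB (fun _ ↦ by positivity)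
    hslack' hRrm hRrt hRrc hreach (fun i n x hx hw hxr hxn ↦ hcov i n x hx hw hxr hxn) hlab
    (by positivity : (0 : ℝ) < 1 + 3 * γ') hR₀0 hrpd hfar hflat

end Summit.FinalStateConjecture.FinalStateConjecture.Theorems

end
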